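import Literature.NumberTheory.LFunctions.WeilArchDensityPanels
import Literature.Analysis.ValidatedNumerics.TaylorModelPhi
import Literature.Analysis.ValidatedNumerics.TaylorModelQuadrature
import Literature.Analysis.ValidatedNumerics.TaylorModelExpr
import HarnessLib

/-!
# The archimedean density of Weil's explicit formula, IV: panel Taylor models of `g(t) = t ρ(t)`
# and the certified panel integrals `∫ g · q`

Topic `Literature/NumberTheory/LFunctions` (sequel of `WeilArchDensityPanels.lean`).  On a panel
`t = c + sρ`, `|ρ| ≤ h₂`, `s h₂ ≤ c`, the regularised density is `g(t) = e^{-t/2}/(2φ(2t))`,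
`φ(u) = (1 − e^{-u})/u` (`weilArchDensityG_eq_phi`), and a Taylor model of `ρ ↦ g(c + sρ)` is assembled from
the generic pieces of `Literature/Analysis/ValidatedNumerics/` — `texpI` (exponential), `tphiLI` (`φ`),
the verified reciprocal `checkInv`, and an `MI.expPt` enclosure of the constant `e^{-c/2}`:

* `gPanelI S h₂ D K Ke ke c s Q e : IPoly`, `gPanelCheck S h₂ D Kφ λ Ke ke c s Q e : Bool`, and `tmem_gPanel` — if the
  check accepts then `gPanelI …` encloses `ρ ↦ g(c + sρ)` on `|ρ| ≤ h₂` (slope `s > 0`, `s h₂ ≤ c`: all panels of `[0, 2b]`);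
* `abs_panelIntegral_sub_le` — `|∫_{-h₂}^{h₂} g(c+sρ) q(ρ) dρ − ∫ p q| ≤ (tabsI(G − p)/S)·2h₂·Σ|qₙ|h₂ⁿ` for
  rational polynomials `p, q` (`TaylorModelQuadrature.abs_integral_mul_sub_integPolyQ_le`), the form in which
  the kernel certifies the archimedean energy integrals panel by panel (data `Q, e, p` from a generator,
  checked by `decide`).

## References

* E. Bombieri, Rend. Mat. Acc. Lincei (9) 11 (2000) 183–233, Thm 2. [cite: Bombieri2000Weil, Thm 2]
* K. Makino, M. Berz, Int. J. Pure Appl. Math. 4 (2003) 379–456 (Taylor models). [folklore]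
-/

open Real Set MeasureTheory intervalIntegral

namespace Literature.NumberTheory.LFunctions

open Literature.Analysis.ValidatedNumerics.PolyMP Literature.Analysis.ValidatedNumerics.NumericsMP
open Literature.Analysis.ValidatedNumerics.ExpPoly (Poly)

/-! ## `g` through `φ` -/

/-- `g(t) = e^{-t/2}/(2φ(2t))` for every `t ≥ 0` (both sides are `1/2` at `t = 0`). [folklore] -/
theorem weilArchDensityG_eq_phi {t : ℝ} (ht : 0 ≤ t) :
    weilArchDensityG t = Real.exp (-(t / 2)) / (2 * phiExp (2 * t)) := by
  rcases ht.eq_or_lt with h | h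
  · subst h
    simp [weilArchDensityG, phiExp]
  · have h2 : (2 : ℝ) * t ≠ 0 := by positivity
    rw [weilArchDensityG_of_ne h.ne', weilArchDensity, phiExp, if_neg h2, Real.sinh_eq]
    set a : ℝ := Real.exp (t / 2) with ha
    have ha0 : 0 < a := Real.exp_pos _
    have ha1 : 1 < a := Real.one_lt_exp_iff.2 (by positivity)
    have e1 : Real.exp t = a ^ 2 := by rw [ha, ← Real.exp_nat_mul]; ring_nf
    have e2 : Real.exp (-t) = (a ^ 2)⁻¹ := by rw [Real.exp_neg, e1]
    have e3 : Real.exp (-(t / 2)) = a⁻¹ := by rw [Real.exp_neg]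
    have e4 : Real.exp (-(2 * t)) = (a ^ 4)⁻¹ := by
      rw [Real.exp_neg, show (2 : ℝ) * t = (4 : ℕ) * (t / 2) by push_cast; ring, Real.exp_nat_mul]
    rw [e1, e2, e3, e4]
    have ha4 : a ^ 4 - 1 ≠ 0 := by
      have : 1 < a ^ 4 := one_lt_pow₀ ha1 (by norm_num)
      linarith
    have ha2 : a ^ 2 - (a ^ 2)⁻¹ ≠ 0 := by
      have h1 : 1 < a ^ 2 := one_lt_pow₀ ha1 two_ne_zero
      have h2 : (a ^ 2)⁻¹ < 1 := inv_lt_one_of_one_lt₀ h1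
      exact ne_of_gt (by linarith)
    field_simp

/-- `ρ ↦ g(c + s ρ)` is interval integrable on `[-h₂, h₂]` when `0 < s` and `s h₂ ≤ c`. [folklore] -/
theorem intervalIntegrable_weilArchDensityG_panel {h₂ c s : ℝ} (h0 : 0 ≤ h₂) (hs : 0 < s) (hc : s * h₂ ≤ c) :
    IntervalIntegrable (fun ρ ↦ weilArchDensityG (c + s * ρ)) volume (-h₂) h₂ := by
  have hsh : 0 ≤ s * h₂ := mul_nonneg hs.le h0
  have h1 := (intervalIntegrable_weilArchDensityG (a := c - s * h₂) (b := c + s * h₂) (by linarith)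
    (by linarith)).comp_add_left c
  have h2 := h1.comp_mul_left (c := s)
  have e1 : (c - s * h₂ - c) / s = -h₂ := by field_simp; ring
  have e2 : (c + s * h₂ - c) / s = h₂ := by field_simp; ring
  rw [e1, e2] at h2
  exact h2

/-! ## Affine Taylor models and the constant `e^{-c/2}` -/

/-- The exact Taylor model of `ρ ↦ a + bρ`. [folklore] -/
def taffineI (S : ℕ) (a b : ℚ) : IPoly := [ofRat S a, ofRat S b]

/-- [folklore] -/
theorem tmem_affine (S : ℕ) (h : ℚ) (a b : ℚ) : TMem S h (fun ρ ↦ (a : ℝ) + b * ρ) (taffineI S a b) :=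
  fun ρ _ ↦ ⟨[(a : ℝ), b], pmem_cons (mem_ofRat S a) (pmem_cons (mem_ofRat S b) (pmem_nil S)), by simp; ring⟩

/-- The kernel enclosure of `e^{x}` for rational `x` (`MI.expPt`; junk `[0,0]` if the enclosure fails, which
the check below excludes). [folklore] -/
def expRatMI (S Ke ke : ℕ) (x : ℚ) : MI := (MI.expPt S Ke ke (ofRat S x)).getD ⟨0, 0⟩

/-- [folklore] -/
theorem mem_expRatMI {S : ℕ} (hS : 0 < S) {Ke ke : ℕ} {x : ℚ} (h : (MI.expPt S Ke ke (ofRat S x)).isSome = true) :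
    MI.mem S (Real.exp x) (expRatMI S Ke ke x) := by
  obtain ⟨Y, hY⟩ := Option.isSome_iff_exists.1 h
  have : expRatMI S Ke ke x = Y := by simp [expRatMI, hY]
  rw [this]
  exact MI.mem_expPt hS hY (mem_ofRat S x)

/-! ## The panel Taylor model of `g` -/

/-- **Panel model of `g(c + ρ)`**, `|ρ| ≤ h₂`:  `e^{-c/2} · e^{-ρ/2} · (1/φ(2c + 2ρ)) / 2`, with `e^{-ρ/2}` by `texpI`
(`K` terms), `φ` by `tphiLI` (`Kφ` terms, truncation degree `D`), `1/φ` the verified reciprocal of the thin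
candidate `Q` (scaled integers) widened by `e`, and `e^{-c/2}` by `expRatMI` (`Ke` terms, `ke` squarings).
[folklore] -/
def gPanelI (S : ℕ) (h₂ : ℚ) (D K Ke ke : ℕ) (c s : ℚ) (Q : List ℤ) (e : ℕ) : IPoly :=
  tdivNat 2 (tmulI S h₂ D (tsmulI S (expRatMI S Ke ke (-c / 2)) (texpI S h₂ K (-s / 2))) (widen0 (thinI Q) e))

/-- The acceptance test of the panel model: the `φ` range condition, the reciprocal certificate, and success of
the constant enclosure. [folklore] -/
def gPanelCheck (S : ℕ) (h₂ : ℚ) (D Kφ lam Ke ke : ℕ) (c s : ℚ) (Q : List ℤ) (e : ℕ) : Bool :=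
  tphiLCheck S h₂ Kφ (taffineI S (2 * c) (2 * s)) &&
    checkInv S h₂ D (tphiLI S h₂ D Kφ lam (taffineI S (2 * c) (2 * s))) (thinI Q) e &&
      (MI.expPt S Ke ke (ofRat S (-c / 2))).isSome

/-- **Soundness of the panel model.**  If `0 ≤ h₂`, `0 < s`, `s h₂ ≤ c`, `s h₂ ≤ 2`, `0 < K`, `0 < Kφ`, `0 < λ` and
`gPanelCheck` accepts, then `gPanelI …` encloses `ρ ↦ g(c + s ρ)` on `|ρ| ≤ h₂`. [folklore] -/
theorem tmem_gPanel {S : ℕ} (hS : 0 < S) {h₂ : ℚ} (h0 : 0 ≤ h₂) {s : ℚ} (hs : 0 < s) (hsh2 : s * h₂ ≤ 2)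
    {D K Kφ lam Ke ke : ℕ} (hK : 0 < K) (hKφ : 0 < Kφ) (hlam : 0 < lam) {c : ℚ} (hc : s * h₂ ≤ c) {Q : List ℤ}
    {e : ℕ} (hchk : gPanelCheck S h₂ D Kφ lam Ke ke c s Q e = true) :
    TMem S h₂ (fun ρ ↦ weilArchDensityG ((c : ℝ) + s * ρ)) (gPanelI S h₂ D K Ke ke c s Q e) := by
  unfold gPanelCheck at hchk
  simp only [Bool.and_eq_true] at hchk
  obtain ⟨⟨hφc, hinvc⟩, hexpc⟩ := hchk
  have hU := tmem_affine S h₂ (2 * c) (2 * s)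
  have hΦ := tmem_phiL hS h0 D hKφ hlam hU hφc
  have hinv := tmem_inv_of_check hS h0 hΦ (tmem_thin hS h₂ Q) hinvc
  have hqh : |(-s / 2 : ℚ) * h₂| ≤ 1 := by
    rw [abs_mul, abs_of_nonneg h0, show |(-s / 2 : ℚ)| = s / 2 by rw [abs_div, abs_neg, abs_of_pos hs]; norm_num]
    linarith
  have hE := tmem_smulI hS (mem_expRatMI hS hexpc) (tmem_exp (S := S) (h := h₂) hK hqh)
  have hprod := tmem_divNat (n := 2) two_pos (tmem_mul hS h0 D hE hinv)
  intro ρ hρ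
  obtain ⟨as, has, hev⟩ := hprod ρ hρ
  refine ⟨as, has, ?_⟩
  rw [← hev]
  beta_reduce
  have ht : 0 ≤ (c : ℝ) + s * ρ := by
    have h1 : -(h₂ : ℝ) ≤ ρ := (abs_le.1 hρ).1
    have hc' : ((s : ℝ) * h₂) ≤ c := by exact_mod_cast hc
    have hs' : (0 : ℝ) < s := by exact_mod_cast hs
    nlinarith
  rw [weilArchDensityG_eq_phi ht]
  have e1 : Real.exp (-(((c : ℝ) + s * ρ) / 2)) = Real.exp (((-c / 2 : ℚ) : ℝ)) * Real.exp (((-s / 2 : ℚ) : ℝ) * ρ) := by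
    rw [← Real.exp_add]; congr 1; push_cast; ring
  have e2 : (2 : ℝ) * ((c : ℝ) + s * ρ) = ((2 * c : ℚ) : ℝ) + ((2 * s : ℚ) : ℝ) * ρ := by push_cast; ring
  rw [e1, e2]
  simp only [div_eq_mul_inv, mul_inv]
  ring

/-! ## The certified panel integral -/

/-- **Panel integral certificate.**  Under the hypotheses of `tmem_gPanel`, for all rational polynomials
`p, q`: `|∫_{-h₂}^{h₂} g(c + sρ) q(ρ) dρ − ∫_{-h₂}^{h₂} p q| ≤ (tabsI S h₂ (G − p)/S) · (2h₂ Σ|qₙ|h₂ⁿ)`,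
`G = gPanelI …`. [folklore] -/
theorem abs_panelIntegral_sub_le {S : ℕ} (hS : 0 < S) {h₂ : ℚ} (h0 : 0 ≤ h₂) {s : ℚ} (hs : 0 < s)
    (hsh2 : s * h₂ ≤ 2) {D K Kφ lam Ke ke : ℕ} (hK : 0 < K) (hKφ : 0 < Kφ) (hlam : 0 < lam) {c : ℚ}
    (hc : s * h₂ ≤ c) {Q : List ℤ} {e : ℕ} (hchk : gPanelCheck S h₂ D Kφ lam Ke ke c s Q e = true) (p q : Poly) :
    |(∫ ρ in (-(h₂ : ℝ))..h₂, weilArchDensityG ((c : ℝ) + s * ρ) * Poly.eval q ρ) - ((integPolyQ p q h₂ : ℚ) : ℝ)| ≤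
      (tabsI S h₂ (tsubI (gPanelI S h₂ D K Ke ke c s Q e) (ratPolyI S p)) : ℝ) / S *
        (2 * h₂ * absBoundQ q h₂) :=
  abs_integral_mul_sub_integPolyQ_le hS h0 (tmem_gPanel hS h0 hs hsh2 hK hKφ hlam hc hchk)
    (intervalIntegrable_weilArchDensityG_panel (by exact_mod_cast h0) (by exact_mod_cast hs)
      (by exact_mod_cast hc)) p q

end Literature.NumberTheory.LFunctions
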